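import Summits.BirchSwinnertonDyer.BirchSwinnertonDyer.Theorems.AlignedTransportAtTwoMainConjectureOfRankZeroBSDAtTwoTwistReadingLayerOne
import Summits.BirchSwinnertonDyer.BirchSwinnertonDyer.Theorems.AlignedTransportAtTwoMainConjectureOfRankZeroBSDAtTwoCubicChevalleyRowN1763
import Summits.BirchSwinnertonDyer.BirchSwinnertonDyer.Theorems.AlignedTransportAtTwoMainConjectureOfRankZeroBSDAtTwoCubicChevalleyRowN2515
import Summits.BirchSwinnertonDyer.BirchSwinnertonDyer.Theorems.AlignedTransportAtTwoMainConjectureOfRankZeroBSDAtTwoCubicChevalleyRowN3115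
import Summits.BirchSwinnertonDyer.BirchSwinnertonDyer.Theorems.AlignedTransportAtTwoMainConjectureOfRankZeroBSDAtTwoCubicChevalleyRowN3371
import Summits.BirchSwinnertonDyer.BirchSwinnertonDyer.Theorems.AlignedTransportAtTwoMainConjectureOfRankZeroBSDAtTwoCubicChevalleyRowN3547
import Summits.BirchSwinnertonDyer.BirchSwinnertonDyer.Theorems.AlignedTransportAtTwoMainConjectureOfRankZeroBSDAtTwoCubicChevalleyRowN4771
import Summits.BirchSwinnertonDyer.BirchSwinnertonDyer.Theorems.AlignedTransportAtTwoMainConjectureOfRankZeroBSDAtTwoCubicChevalleyRowN4883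
import Summits.BirchSwinnertonDyer.BirchSwinnertonDyer.Theorems.AlignedTransportAtTwoMainConjectureOfRankZeroBSDAtTwoCubicChevalleyRow307b1
import Summits.BirchSwinnertonDyer.BirchSwinnertonDyer.Theorems.AlignedTransportAtTwoMainConjectureOfRankZeroBSDAtTwoCubicChevalleyRow139a1
import Literature.NumberTheory.EllipticCurves.PAdicLFunctionIntegralityAtTwoAutoProofs
import HarnessLib

/-!
# Route `AlignedTransportAtTwo`, crux C2 `MainConjectureOfRankZeroBSDAtTwo` (stmt-BirchSwinnertonDyer-22298):
# THE TWIST READING IN THE ROAD'S CURRENCY, AND NINE ROWS — for each kernel-certified `a₂ = +1` road curve `E_N` (N = 139, 307, 1763, 2515, 3115, 3371, 3547, 4771, 4883)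
# the quadratic twist by `2` (conductor `64N`) has **`rank E_N⁽²⁾(ℚ) ≤ corank_{ℤ₂} Sel_{2^∞}(E_N⁽²⁾/ℚ) ≤ 1`** modulo PRINT `h17` + `hper` + `hmod`, `r_an(E_N) = 0` and the row's `L`-value datum

HONEST FRAMING (cell `bsd-f1-sign2`, WIDTH-5 attached prover seat `bsd-line-att-p5` gen 38 on line `birth` of the lead `bsd-line-att-p2`;
`--supports` stmt-BirchSwinnertonDyer-22298, closes nothing; BSD is NOT proved by any of this; the crux C2, its verdict «blocked-on
`Rank1Residual.GreenbergMuConjectureIrreducible`» and every registered stub are untouched). THEOREMS ONLY — no `def`, no instance, no named fact, no `sorry`.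
PRINT binders: `h17` Kato 17.4 (1)(2) at `2` (conductor-level newform), `hper` the period unit at `2`, `hmod` modularity (a newform at level `N_W`), `hGZK` in the layer-one
forms; certificates: `r_an(W) = 0` and the road's `L`-value datum «`L(W,1)/Ω_W = q`, `q ≠ 0`, `ord₂ q = 0`» (for the nine rows: `q = 1`, CHI8-att-p5-g32 §6 / LVALUE-BIT-att-p5-g30).
A -data check (memo TWIST-READING-att-p5-g38 §4, D-g38-1): each conclusion is an LMFDB-visible prediction `rank E_N^{(8)}(ℚ) ≤ 1` (parity: `= 1`).

* §1 road currency (`a₂ = +1`, `∏ c_v` odd, `Δ_min ≡ 3, 5 (mod 8)`, `r_an = 0`, no rational `2`-torsion abscissa, `L`-value datum): ★★ `selmerCorank_quadraticTwist_two_le_one_of_road_of_lValue`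
  (**`corank_{ℤ₂} Sel_{2^∞}(W⁽²⁾/ℚ) ≤ 1`, `rank W⁽²⁾(ℚ) ≤ 1`**); ★ `selmerCorank_layer_one_le_one_of_road_of_lValue` (**`corank_{ℤ₂} Sel_{2^∞}(W/ℚ(√2)) ≤ 1`**, `+ hGZK`);
  `selmerCorank_quadraticTwist_two_le_three_of_road_of_lValue` (`a₂ = −1`: `≤ 3`).
* §2 ★ the nine rows `selmerCorank_quadraticTwist_two_le_one_n<N>` (every curve-specific binder — good ordinary reduction at `2`, `a₂ = +1` from `#Ẽ(𝔽₂) = 2`, `Δ_min = −N ≡ 5 (mod 8)`,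
  `∏ c_v` odd, no rational `2`-torsion abscissa — decided by the kernel from the row files of g31/g32).

References: K. Kato, Astérisque 295 (2004), Thm. 17.4 [Kato2004Asterisque]; R. Greenberg, LNM 1716 (1999), §3 Lemma 3.1, §4 p. 107 [GreenbergLNM1716]; B. Mazur, J. Tate, J. Teitelbaum,
Invent. Math. 84 (1986) §I.14 [MazurTateTeitelbaum1986Invent]; A. Abbes, E. Ullmo, Compositio 103 (1996), Thm. A [AbbesUllmo1996]; J. Cremona, *Algorithms for Modular Elliptic Curves* (tables)
[Cremona1997].
-/

set_option linter.dupNamespace false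
set_option autoImplicit false

noncomputable section

open scoped Classical MatrixGroups ModularForm

namespace Summit.BirchSwinnertonDyer.BirchSwinnertonDyer.Theorems.AlignedTransportAtTwoTwistReadingRows

open PowerSeries CongruenceSubgroup WeierstrassCurve Literature.NumberTheory.EllipticCurves
  Literature.NumberTheory.EllipticCurves.ModularForms
  Literature.NumberTheory.EllipticCurves.Rank1Residual
  Literature.NumberTheory.EllipticCurves.Rank1Residual.Typed
  Literature.NumberTheory.EllipticCurves.Greenberg1999
  Summit.BirchSwinnertonDyer.Rank1Residual
  Summit.BirchSwinnertonDyer.Rank1Residual.X1.MuLambda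
  Summit.BirchSwinnertonDyer.Rank1Residual.X5
  Summit.BirchSwinnertonDyer.Rank1Residual.X5.Instances
  Summit.BirchSwinnertonDyer.Rank1Residual.F1Sign2
  Summit.BirchSwinnertonDyer.BirchSwinnertonDyer.Theorems.Rank1ResidualX1Defs
  Summit.BirchSwinnertonDyer.BirchSwinnertonDyer.Theorems.AlignedTransportAtTwoSeed
  Summit.BirchSwinnertonDyer.BirchSwinnertonDyer.Theorems.AlignedTransportAtTwoTwoFixedPoints
  Summit.BirchSwinnertonDyer.BirchSwinnertonDyer.Theorems.AlignedTransportAtTwoRoadSecondFixedPoint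
  Summit.BirchSwinnertonDyer.BirchSwinnertonDyer.Theorems.AlignedTransportAtTwoTwistReading
  Summit.BirchSwinnertonDyer.BirchSwinnertonDyer.Theorems.AlignedTransportAtTwoTwistReadingBounds
  Summit.BirchSwinnertonDyer.BirchSwinnertonDyer.Theorems.AlignedTransportAtTwoTwistReadingLayerOne

/-! ## §1 The road's currency: `hmod` supplies the newform, `hper` + the `L`-value datum supply the unit central symbol -/

section Road

variable (W : WeierstrassCurve ℚ) [W.IsElliptic] [W.IsGloballyMinimal]

/-- ★★ **`a₂ = +1` road, road currency: `corank_{ℤ₂} Sel_{2^∞}(W⁽²⁾/ℚ) ≤ 1` and `rank W⁽²⁾(ℚ) ≤ 1`.** `W` globally minimal, good ordinary at `2`, no rational `2`-torsion abscissa,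
`a₂ = +1`, `∏ c_v` odd, `Δ_min ≡ 3, 5 (mod 8)`, `r_an(W) = 0`, and «`L(W,1)/Ω_W = q`, `q ≠ 0`, `ord₂ q = 0`»; PRINT `h17` (conductor-level newform), `hper`, `hmod`. (`hmod` gives the newform `f`,
MTT integrality the lift `G`, `hper` + the datum give `‖[0]⁺_f‖₂ = 1`; then `…TwistReading.selmerCorank_twist_le_one_of_road`.) [cite: Kato2004Asterisque, Thm. 17.4 (1)(2) (p. 273)]
[cite: GreenbergLNM1716, §3 Lemma 3.1, §4 p. 107] [cite: AbbesUllmo1996, Thm. A] -/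
theorem selmerCorank_quadraticTwist_two_le_one_of_road_of_lValue
    (h17 : ∀ [NeZero (W.conductorNorm ℤ)] (f : CuspForm (Gamma0 (W.conductorNorm ℤ)) 2), kato_divisibility_allPrimes W 2 (f := f))
    (hper : realPeriodRat_eq_unit_mul_plusPeriod_two) (hmod : nonempty_modularParametrizationData) (hord : IsOrdinaryAt W 2)
    (ht : ∀ x : ℚ, ¬ HasRationalTwoTorsionX W x) (ha : W.frobeniusTrace 2 = 1) (hodd : Odd W.tamagawaProduct)
    (hΔ : minimalDiscriminantInt W % 8 = 3 ∨ minimalDiscriminantInt W % 8 = 5) (hr : W.analyticRank = 0)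
    (hL : ∃ q : ℚ, q ≠ 0 ∧ W.entireLFunction 1 / (W.realPeriodRat : ℂ) = (q : ℂ) ∧ padicValRat 2 q = 0) :
    (W.quadraticTwist 2).selmerCorank 2 ≤ 1 ∧ (W.quadraticTwist 2).mordellWeilRank ≤ 1 := by
  haveI : NeZero (W.conductorNorm ℤ) := ⟨(W.conductorNorm_pos_holds).ne'⟩
  haveI : (W.quadraticTwist (2 : ℚ)).IsElliptic := W.isElliptic_quadraticTwist two_ne_zero
  obtain ⟨Dm⟩ := hmod W
  have hf : IsNewformOf W Dm.f := Dm.isNewformOf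
  obtain ⟨G, hG⟩ := exists_iwasawaToPowerSeries_eq_padicLFunction_two_auto hord hf
  have hirr : Irr W 2 := irr_two_of_forall_not_hasRationalTwoTorsionX W ht
  have hsym : ‖(ratPlusSymbol Dm.f 0 : ℚ_[2])‖ = 1 := norm_ratPlusSymbol_zero_eq_one_of_lValue hper hord.1 hirr hf hL
  exact selmerCorank_twist_le_one_of_road W (W.quadraticTwist 2) (V := 1) (one_smul _ _) (h17 Dm.f) hord hf ha hodd hΔ hr hG hsym

/-- ★ **`a₂ = +1` road, road currency: `corank_{ℤ₂} Sel_{2^∞}(W/ℚ(√2)) ≤ 1` and `rank W(ℚ(√2)) + corank Ш(W/ℚ(√2))[2^∞] ≤ 1`** at the first layer `ℚ_1 = ℚ(√2)` of any cyclotomic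
`ℤ₂`-extension (hypotheses as above, plus `hGZK` for `corank Sel_{2^∞}(W/ℚ) = 0`). [cite: Kato2004Asterisque, Thm. 17.4 (1)(2) (p. 273)] [cite: DokchitserDokchitserAnnals2010, Lemma 4.14]
[cite: GreenbergLNM1716, §1 pp. 53–57, §4 p. 107] -/
theorem selmerCorank_layer_one_le_one_of_road_of_lValue
    (h17 : ∀ [NeZero (W.conductorNorm ℤ)] (f : CuspForm (Gamma0 (W.conductorNorm ℤ)) 2), kato_divisibility_allPrimes W 2 (f := f))
    (hper : realPeriodRat_eq_unit_mul_plusPeriod_two) (hmod : nonempty_modularParametrizationData)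
    (hGZK : rank_eq_analyticRank_of_analyticRank_le_one) (hord : IsOrdinaryAt W 2)
    (ht : ∀ x : ℚ, ¬ HasRationalTwoTorsionX W x) (ha : W.frobeniusTrace 2 = 1) (hodd : Odd W.tamagawaProduct)
    (hΔ : minimalDiscriminantInt W % 8 = 3 ∨ minimalDiscriminantInt W % 8 = 5) (hr : W.analyticRank = 0)
    (hL : ∃ q : ℚ, q ≠ 0 ∧ W.entireLFunction 1 / (W.realPeriodRat : ℂ) = (q : ℂ) ∧ padicValRat 2 q = 0)
    {κ : ZpExtension ℚ 2} [NumberField (κ.layer 1)] (hκ : κ.IsCyclotomic) :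
    (W.baseChange (κ.layer 1)).selmerCorank 2 ≤ 1 ∧
      (W.baseChange (κ.layer 1)).mordellWeilRank + (W.baseChange (κ.layer 1)).shaCorank 2 ≤ 1 := by
  haveI : NeZero (W.conductorNorm ℤ) := ⟨(W.conductorNorm_pos_holds).ne'⟩
  obtain ⟨Dm⟩ := hmod W
  have hf : IsNewformOf W Dm.f := Dm.isNewformOf
  obtain ⟨G, hG⟩ := exists_iwasawaToPowerSeries_eq_padicLFunction_two_auto hord hf
  have hirr : Irr W 2 := irr_two_of_forall_not_hasRationalTwoTorsionX W ht
  have hsym : ‖(ratPlusSymbol Dm.f 0 : ℚ_[2])‖ = 1 := norm_ratPlusSymbol_zero_eq_one_of_lValue hper hord.1 hirr hf hL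
  exact selmerCorank_layer_one_le_one_of_road W (h17 Dm.f) hGZK hord hf ha hodd hΔ hr hG hsym hκ

/-- **`a₂ = −1` road, road currency: `corank_{ℤ₂} Sel_{2^∞}(W⁽²⁾/ℚ) ≤ 3` and `rank W⁽²⁾(ℚ) ≤ 3`.** [cite: Kato2004Asterisque, Thm. 17.4 (1)(2) (p. 273)]
[cite: GreenbergLNM1716, §4 p. 107, §5 p. 181] -/
theorem selmerCorank_quadraticTwist_two_le_three_of_road_of_lValue
    (h17 : ∀ [NeZero (W.conductorNorm ℤ)] (f : CuspForm (Gamma0 (W.conductorNorm ℤ)) 2), kato_divisibility_allPrimes W 2 (f := f))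
    (hper : realPeriodRat_eq_unit_mul_plusPeriod_two) (hmod : nonempty_modularParametrizationData) (hord : IsOrdinaryAt W 2)
    (ht : ∀ x : ℚ, ¬ HasRationalTwoTorsionX W x) (ha : W.frobeniusTrace 2 = -1) (hodd : Odd W.tamagawaProduct)
    (hΔ : minimalDiscriminantInt W % 8 = 3 ∨ minimalDiscriminantInt W % 8 = 5) (hr : W.analyticRank = 0)
    (hL : ∃ q : ℚ, q ≠ 0 ∧ W.entireLFunction 1 / (W.realPeriodRat : ℂ) = (q : ℂ) ∧ padicValRat 2 q = 0) :
    (W.quadraticTwist 2).selmerCorank 2 ≤ 3 ∧ (W.quadraticTwist 2).mordellWeilRank ≤ 3 := by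
  haveI : NeZero (W.conductorNorm ℤ) := ⟨(W.conductorNorm_pos_holds).ne'⟩
  haveI : (W.quadraticTwist (2 : ℚ)).IsElliptic := W.isElliptic_quadraticTwist two_ne_zero
  obtain ⟨Dm⟩ := hmod W
  have hf : IsNewformOf W Dm.f := Dm.isNewformOf
  obtain ⟨G, hG⟩ := exists_iwasawaToPowerSeries_eq_padicLFunction_two_auto hord hf
  have hirr : Irr W 2 := irr_two_of_forall_not_hasRationalTwoTorsionX W ht
  have hsym : ‖(ratPlusSymbol Dm.f 0 : ℚ_[2])‖ = 1 := norm_ratPlusSymbol_zero_eq_one_of_lValue hper hord.1 hirr hf hL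
  exact selmerCorank_twist_le_three_of_road_of_frobeniusTrace_eq_neg_one W (W.quadraticTwist 2) (V := 1) (one_smul _ _) (h17 Dm.f) hord hf
    ha hodd hΔ hr hG hsym

end Road

/-! ## §2 Nine rows: the kernel-certified `a₂ = +1` road curves of the CHI8 census -/

section Rows

/-- ★ **Conductor `139` (`[1, 1, 0, -3, -4]`): `corank_{ℤ₂} Sel_{2^∞}(E⁽²⁾/ℚ) ≤ 1` and `rank E⁽²⁾(ℚ) ≤ 1` for the twist by `2`** (conductor `64·139`), modulo PRINT `h17`, `hper`, `hmod`,
the certificate `r_an(E) = 0` and the `L`-value datum (`q = 1` numerically); `a₂ = +1` (`#Ẽ(𝔽₂) = 2`), `Δ_min = −139 ≡ 5 (mod 8)`, `∏ c_v` odd, good ordinary at `2`, no rational `2`-torsion abscissa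
are the row file's kernel facts. [cite: Kato2004Asterisque, Thm. 17.4 (1)(2) (p. 273)] [cite: Cremona1997, Table 1 (curve of conductor 139)] -/
theorem selmerCorank_quadraticTwist_two_le_one_139a1
    [((⟨1, 1, 0, -3, -4⟩ : WeierstrassCurve ℤ).baseChange ℚ).IsElliptic] [((⟨1, 1, 0, -3, -4⟩ : WeierstrassCurve ℤ).baseChange ℚ).IsGloballyMinimal]
    (h17 : ∀ [NeZero (((⟨1, 1, 0, -3, -4⟩ : WeierstrassCurve ℤ).baseChange ℚ).conductorNorm ℤ)]
      (f : CuspForm (Gamma0 (((⟨1, 1, 0, -3, -4⟩ : WeierstrassCurve ℤ).baseChange ℚ).conductorNorm ℤ)) 2),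
      kato_divisibility_allPrimes ((⟨1, 1, 0, -3, -4⟩ : WeierstrassCurve ℤ).baseChange ℚ) 2 (f := f))
    (hper : realPeriodRat_eq_unit_mul_plusPeriod_two) (hmod : nonempty_modularParametrizationData)
    (hr : ((⟨1, 1, 0, -3, -4⟩ : WeierstrassCurve ℤ).baseChange ℚ).analyticRank = 0)
    (hL : ∃ q : ℚ, q ≠ 0 ∧ ((⟨1, 1, 0, -3, -4⟩ : WeierstrassCurve ℤ).baseChange ℚ).entireLFunction 1 /
      ((((⟨1, 1, 0, -3, -4⟩ : WeierstrassCurve ℤ).baseChange ℚ).realPeriodRat : ℂ)) = (q : ℂ) ∧ padicValRat 2 q = 0) :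
    (((⟨1, 1, 0, -3, -4⟩ : WeierstrassCurve ℤ).baseChange ℚ).quadraticTwist 2).selmerCorank 2 ≤ 1 ∧
      (((⟨1, 1, 0, -3, -4⟩ : WeierstrassCurve ℤ).baseChange ℚ).quadraticTwist 2).mordellWeilRank ≤ 1 :=
  selmerCorank_quadraticTwist_two_le_one_of_road_of_lValue _ h17 hper hmod Summit.BirchSwinnertonDyer.BirchSwinnertonDyer.Theorems.AlignedTransportAtTwoCubicChevalleyRow139a1.goodOrd_two_139a1
    Summit.BirchSwinnertonDyer.BirchSwinnertonDyer.Theorems.AlignedTransportAtTwoCubicChevalleyRow139a1.not_hasRationalTwoTorsionX_139a1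
    (by rw [frobeniusTrace, Literature.NumberTheory.EllipticCurves.reductionPointCount_baseChange_int, Summit.BirchSwinnertonDyer.BirchSwinnertonDyer.Theorems.AlignedTransportAtTwoCubicChevalleyRow139a1.M139a1_card_two]; decide)
    Summit.BirchSwinnertonDyer.BirchSwinnertonDyer.Theorems.AlignedTransportAtTwoCubicChevalleyRow139a1.odd_tamagawaProduct_139a1
    (Or.inr (by rw [Summit.BirchSwinnertonDyer.BirchSwinnertonDyer.Theorems.AlignedTransportAtTwoCubicChevalleyRow139a1.minimalDiscriminantInt_139a1]; decide)) hr hL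

/-- ★ **Conductor `307` (`[1, 1, 0, 0, -1]`): `corank_{ℤ₂} Sel_{2^∞}(E⁽²⁾/ℚ) ≤ 1` and `rank E⁽²⁾(ℚ) ≤ 1` for the twist by `2`** (conductor `64·307`), modulo PRINT `h17`, `hper`, `hmod`,
the certificate `r_an(E) = 0` and the `L`-value datum (`q = 1` numerically); `a₂ = +1` (`#Ẽ(𝔽₂) = 2`), `Δ_min = −307 ≡ 5 (mod 8)`, `∏ c_v` odd, good ordinary at `2`, no rational `2`-torsion abscissa
are the row file's kernel facts. [cite: Kato2004Asterisque, Thm. 17.4 (1)(2) (p. 273)] [cite: Cremona1997, Table 1 (curve of conductor 307)] -/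
theorem selmerCorank_quadraticTwist_two_le_one_307b1
    [((⟨1, 1, 0, 0, -1⟩ : WeierstrassCurve ℤ).baseChange ℚ).IsElliptic] [((⟨1, 1, 0, 0, -1⟩ : WeierstrassCurve ℤ).baseChange ℚ).IsGloballyMinimal]
    (h17 : ∀ [NeZero (((⟨1, 1, 0, 0, -1⟩ : WeierstrassCurve ℤ).baseChange ℚ).conductorNorm ℤ)]
      (f : CuspForm (Gamma0 (((⟨1, 1, 0, 0, -1⟩ : WeierstrassCurve ℤ).baseChange ℚ).conductorNorm ℤ)) 2),
      kato_divisibility_allPrimes ((⟨1, 1, 0, 0, -1⟩ : WeierstrassCurve ℤ).baseChange ℚ) 2 (f := f))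
    (hper : realPeriodRat_eq_unit_mul_plusPeriod_two) (hmod : nonempty_modularParametrizationData)
    (hr : ((⟨1, 1, 0, 0, -1⟩ : WeierstrassCurve ℤ).baseChange ℚ).analyticRank = 0)
    (hL : ∃ q : ℚ, q ≠ 0 ∧ ((⟨1, 1, 0, 0, -1⟩ : WeierstrassCurve ℤ).baseChange ℚ).entireLFunction 1 /
      ((((⟨1, 1, 0, 0, -1⟩ : WeierstrassCurve ℤ).baseChange ℚ).realPeriodRat : ℂ)) = (q : ℂ) ∧ padicValRat 2 q = 0) :
    (((⟨1, 1, 0, 0, -1⟩ : WeierstrassCurve ℤ).baseChange ℚ).quadraticTwist 2).selmerCorank 2 ≤ 1 ∧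
      (((⟨1, 1, 0, 0, -1⟩ : WeierstrassCurve ℤ).baseChange ℚ).quadraticTwist 2).mordellWeilRank ≤ 1 :=
  selmerCorank_quadraticTwist_two_le_one_of_road_of_lValue _ h17 hper hmod Summit.BirchSwinnertonDyer.BirchSwinnertonDyer.Theorems.AlignedTransportAtTwoCubicChevalleyRow307b1.goodOrd_two_307b1
    Summit.BirchSwinnertonDyer.BirchSwinnertonDyer.Theorems.AlignedTransportAtTwoCubicChevalleyRow307b1.not_hasRationalTwoTorsionX_307b1
    (by rw [frobeniusTrace, Literature.NumberTheory.EllipticCurves.reductionPointCount_baseChange_int, Summit.BirchSwinnertonDyer.BirchSwinnertonDyer.Theorems.AlignedTransportAtTwoCubicChevalleyRow307b1.M307b1_card_two]; decide)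
    Summit.BirchSwinnertonDyer.BirchSwinnertonDyer.Theorems.AlignedTransportAtTwoCubicChevalleyRow307b1.odd_tamagawaProduct_307b1
    (Or.inr (by rw [Summit.BirchSwinnertonDyer.BirchSwinnertonDyer.Theorems.AlignedTransportAtTwoCubicChevalleyRow307b1.minimalDiscriminantInt_307b1]; decide)) hr hL

/-- ★ **Conductor `1763` (`[1, 0, 1, -3, -3]`): `corank_{ℤ₂} Sel_{2^∞}(E⁽²⁾/ℚ) ≤ 1` and `rank E⁽²⁾(ℚ) ≤ 1` for the twist by `2`** (conductor `64·1763`), modulo PRINT `h17`, `hper`, `hmod`,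
the certificate `r_an(E) = 0` and the `L`-value datum (`q = 1` numerically); `a₂ = +1` (`#Ẽ(𝔽₂) = 2`), `Δ_min = −1763 ≡ 5 (mod 8)`, `∏ c_v` odd, good ordinary at `2`, no rational `2`-torsion abscissa
are the row file's kernel facts. [cite: Kato2004Asterisque, Thm. 17.4 (1)(2) (p. 273)] [cite: Cremona1997, Table 1 (curve of conductor 1763)] -/
theorem selmerCorank_quadraticTwist_two_le_one_n1763
    [((⟨1, 0, 1, -3, -3⟩ : WeierstrassCurve ℤ).baseChange ℚ).IsElliptic] [((⟨1, 0, 1, -3, -3⟩ : WeierstrassCurve ℤ).baseChange ℚ).IsGloballyMinimal]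
    (h17 : ∀ [NeZero (((⟨1, 0, 1, -3, -3⟩ : WeierstrassCurve ℤ).baseChange ℚ).conductorNorm ℤ)]
      (f : CuspForm (Gamma0 (((⟨1, 0, 1, -3, -3⟩ : WeierstrassCurve ℤ).baseChange ℚ).conductorNorm ℤ)) 2),
      kato_divisibility_allPrimes ((⟨1, 0, 1, -3, -3⟩ : WeierstrassCurve ℤ).baseChange ℚ) 2 (f := f))
    (hper : realPeriodRat_eq_unit_mul_plusPeriod_two) (hmod : nonempty_modularParametrizationData)
    (hr : ((⟨1, 0, 1, -3, -3⟩ : WeierstrassCurve ℤ).baseChange ℚ).analyticRank = 0)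
    (hL : ∃ q : ℚ, q ≠ 0 ∧ ((⟨1, 0, 1, -3, -3⟩ : WeierstrassCurve ℤ).baseChange ℚ).entireLFunction 1 /
      ((((⟨1, 0, 1, -3, -3⟩ : WeierstrassCurve ℤ).baseChange ℚ).realPeriodRat : ℂ)) = (q : ℂ) ∧ padicValRat 2 q = 0) :
    (((⟨1, 0, 1, -3, -3⟩ : WeierstrassCurve ℤ).baseChange ℚ).quadraticTwist 2).selmerCorank 2 ≤ 1 ∧
      (((⟨1, 0, 1, -3, -3⟩ : WeierstrassCurve ℤ).baseChange ℚ).quadraticTwist 2).mordellWeilRank ≤ 1 :=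
  selmerCorank_quadraticTwist_two_le_one_of_road_of_lValue _ h17 hper hmod Summit.BirchSwinnertonDyer.BirchSwinnertonDyer.Theorems.AlignedTransportAtTwoCubicChevalleyRowN1763.goodOrd_two_n1763
    Summit.BirchSwinnertonDyer.BirchSwinnertonDyer.Theorems.AlignedTransportAtTwoCubicChevalleyRowN1763.not_hasRationalTwoTorsionX_n1763
    (by rw [frobeniusTrace, Literature.NumberTheory.EllipticCurves.reductionPointCount_baseChange_int, Summit.BirchSwinnertonDyer.BirchSwinnertonDyer.Theorems.AlignedTransportAtTwoCubicChevalleyRowN1763.M1763_card_two]; decide)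
    Summit.BirchSwinnertonDyer.BirchSwinnertonDyer.Theorems.AlignedTransportAtTwoCubicChevalleyRowN1763.odd_tamagawaProduct_n1763
    (Or.inr (by rw [Summit.BirchSwinnertonDyer.BirchSwinnertonDyer.Theorems.AlignedTransportAtTwoCubicChevalleyRowN1763.minimalDiscriminantInt_n1763]; decide)) hr hL

/-- ★ **Conductor `2515` (`[1, 1, 0, 2, 3]`): `corank_{ℤ₂} Sel_{2^∞}(E⁽²⁾/ℚ) ≤ 1` and `rank E⁽²⁾(ℚ) ≤ 1` for the twist by `2`** (conductor `64·2515`), modulo PRINT `h17`, `hper`, `hmod`,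
the certificate `r_an(E) = 0` and the `L`-value datum (`q = 1` numerically); `a₂ = +1` (`#Ẽ(𝔽₂) = 2`), `Δ_min = −2515 ≡ 5 (mod 8)`, `∏ c_v` odd, good ordinary at `2`, no rational `2`-torsion abscissa
are the row file's kernel facts. [cite: Kato2004Asterisque, Thm. 17.4 (1)(2) (p. 273)] [cite: Cremona1997, Table 1 (curve of conductor 2515)] -/
theorem selmerCorank_quadraticTwist_two_le_one_n2515
    [((⟨1, 1, 0, 2, 3⟩ : WeierstrassCurve ℤ).baseChange ℚ).IsElliptic] [((⟨1, 1, 0, 2, 3⟩ : WeierstrassCurve ℤ).baseChange ℚ).IsGloballyMinimal]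
    (h17 : ∀ [NeZero (((⟨1, 1, 0, 2, 3⟩ : WeierstrassCurve ℤ).baseChange ℚ).conductorNorm ℤ)]
      (f : CuspForm (Gamma0 (((⟨1, 1, 0, 2, 3⟩ : WeierstrassCurve ℤ).baseChange ℚ).conductorNorm ℤ)) 2),
      kato_divisibility_allPrimes ((⟨1, 1, 0, 2, 3⟩ : WeierstrassCurve ℤ).baseChange ℚ) 2 (f := f))
    (hper : realPeriodRat_eq_unit_mul_plusPeriod_two) (hmod : nonempty_modularParametrizationData)
    (hr : ((⟨1, 1, 0, 2, 3⟩ : WeierstrassCurve ℤ).baseChange ℚ).analyticRank = 0)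
    (hL : ∃ q : ℚ, q ≠ 0 ∧ ((⟨1, 1, 0, 2, 3⟩ : WeierstrassCurve ℤ).baseChange ℚ).entireLFunction 1 /
      ((((⟨1, 1, 0, 2, 3⟩ : WeierstrassCurve ℤ).baseChange ℚ).realPeriodRat : ℂ)) = (q : ℂ) ∧ padicValRat 2 q = 0) :
    (((⟨1, 1, 0, 2, 3⟩ : WeierstrassCurve ℤ).baseChange ℚ).quadraticTwist 2).selmerCorank 2 ≤ 1 ∧
      (((⟨1, 1, 0, 2, 3⟩ : WeierstrassCurve ℤ).baseChange ℚ).quadraticTwist 2).mordellWeilRank ≤ 1 :=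
  selmerCorank_quadraticTwist_two_le_one_of_road_of_lValue _ h17 hper hmod Summit.BirchSwinnertonDyer.BirchSwinnertonDyer.Theorems.AlignedTransportAtTwoCubicChevalleyRowN2515.goodOrd_two_n2515
    Summit.BirchSwinnertonDyer.BirchSwinnertonDyer.Theorems.AlignedTransportAtTwoCubicChevalleyRowN2515.not_hasRationalTwoTorsionX_n2515
    (by rw [frobeniusTrace, Literature.NumberTheory.EllipticCurves.reductionPointCount_baseChange_int, Summit.BirchSwinnertonDyer.BirchSwinnertonDyer.Theorems.AlignedTransportAtTwoCubicChevalleyRowN2515.M2515_card_two]; decide)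
    Summit.BirchSwinnertonDyer.BirchSwinnertonDyer.Theorems.AlignedTransportAtTwoCubicChevalleyRowN2515.odd_tamagawaProduct_n2515
    (Or.inr (by rw [Summit.BirchSwinnertonDyer.BirchSwinnertonDyer.Theorems.AlignedTransportAtTwoCubicChevalleyRowN2515.minimalDiscriminantInt_n2515]; decide)) hr hL

/-- ★ **Conductor `3115` (`[1, -1, 0, -5, -4]`): `corank_{ℤ₂} Sel_{2^∞}(E⁽²⁾/ℚ) ≤ 1` and `rank E⁽²⁾(ℚ) ≤ 1` for the twist by `2`** (conductor `64·3115`), modulo PRINT `h17`, `hper`, `hmod`,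
the certificate `r_an(E) = 0` and the `L`-value datum (`q = 1` numerically); `a₂ = +1` (`#Ẽ(𝔽₂) = 2`), `Δ_min = −3115 ≡ 5 (mod 8)`, `∏ c_v` odd, good ordinary at `2`, no rational `2`-torsion abscissa
are the row file's kernel facts. [cite: Kato2004Asterisque, Thm. 17.4 (1)(2) (p. 273)] [cite: Cremona1997, Table 1 (curve of conductor 3115)] -/
theorem selmerCorank_quadraticTwist_two_le_one_n3115
    [((⟨1, -1, 0, -5, -4⟩ : WeierstrassCurve ℤ).baseChange ℚ).IsElliptic] [((⟨1, -1, 0, -5, -4⟩ : WeierstrassCurve ℤ).baseChange ℚ).IsGloballyMinimal]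
    (h17 : ∀ [NeZero (((⟨1, -1, 0, -5, -4⟩ : WeierstrassCurve ℤ).baseChange ℚ).conductorNorm ℤ)]
      (f : CuspForm (Gamma0 (((⟨1, -1, 0, -5, -4⟩ : WeierstrassCurve ℤ).baseChange ℚ).conductorNorm ℤ)) 2),
      kato_divisibility_allPrimes ((⟨1, -1, 0, -5, -4⟩ : WeierstrassCurve ℤ).baseChange ℚ) 2 (f := f))
    (hper : realPeriodRat_eq_unit_mul_plusPeriod_two) (hmod : nonempty_modularParametrizationData)
    (hr : ((⟨1, -1, 0, -5, -4⟩ : WeierstrassCurve ℤ).baseChange ℚ).analyticRank = 0)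
    (hL : ∃ q : ℚ, q ≠ 0 ∧ ((⟨1, -1, 0, -5, -4⟩ : WeierstrassCurve ℤ).baseChange ℚ).entireLFunction 1 /
      ((((⟨1, -1, 0, -5, -4⟩ : WeierstrassCurve ℤ).baseChange ℚ).realPeriodRat : ℂ)) = (q : ℂ) ∧ padicValRat 2 q = 0) :
    (((⟨1, -1, 0, -5, -4⟩ : WeierstrassCurve ℤ).baseChange ℚ).quadraticTwist 2).selmerCorank 2 ≤ 1 ∧
      (((⟨1, -1, 0, -5, -4⟩ : WeierstrassCurve ℤ).baseChange ℚ).quadraticTwist 2).mordellWeilRank ≤ 1 :=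
  selmerCorank_quadraticTwist_two_le_one_of_road_of_lValue _ h17 hper hmod Summit.BirchSwinnertonDyer.BirchSwinnertonDyer.Theorems.AlignedTransportAtTwoCubicChevalleyRowN3115.goodOrd_two_n3115
    Summit.BirchSwinnertonDyer.BirchSwinnertonDyer.Theorems.AlignedTransportAtTwoCubicChevalleyRowN3115.not_hasRationalTwoTorsionX_n3115
    (by rw [frobeniusTrace, Literature.NumberTheory.EllipticCurves.reductionPointCount_baseChange_int, Summit.BirchSwinnertonDyer.BirchSwinnertonDyer.Theorems.AlignedTransportAtTwoCubicChevalleyRowN3115.M3115_card_two]; decide)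
    Summit.BirchSwinnertonDyer.BirchSwinnertonDyer.Theorems.AlignedTransportAtTwoCubicChevalleyRowN3115.odd_tamagawaProduct_n3115
    (Or.inr (by rw [Summit.BirchSwinnertonDyer.BirchSwinnertonDyer.Theorems.AlignedTransportAtTwoCubicChevalleyRowN3115.minimalDiscriminantInt_n3115]; decide)) hr hL

/-- ★ **Conductor `3371` (`[1, 0, 1, 0, -3]`): `corank_{ℤ₂} Sel_{2^∞}(E⁽²⁾/ℚ) ≤ 1` and `rank E⁽²⁾(ℚ) ≤ 1` for the twist by `2`** (conductor `64·3371`), modulo PRINT `h17`, `hper`, `hmod`,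
the certificate `r_an(E) = 0` and the `L`-value datum (`q = 1` numerically); `a₂ = +1` (`#Ẽ(𝔽₂) = 2`), `Δ_min = −3371 ≡ 5 (mod 8)`, `∏ c_v` odd, good ordinary at `2`, no rational `2`-torsion abscissa
are the row file's kernel facts. [cite: Kato2004Asterisque, Thm. 17.4 (1)(2) (p. 273)] [cite: Cremona1997, Table 1 (curve of conductor 3371)] -/
theorem selmerCorank_quadraticTwist_two_le_one_n3371
    [((⟨1, 0, 1, 0, -3⟩ : WeierstrassCurve ℤ).baseChange ℚ).IsElliptic] [((⟨1, 0, 1, 0, -3⟩ : WeierstrassCurve ℤ).baseChange ℚ).IsGloballyMinimal]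
    (h17 : ∀ [NeZero (((⟨1, 0, 1, 0, -3⟩ : WeierstrassCurve ℤ).baseChange ℚ).conductorNorm ℤ)]
      (f : CuspForm (Gamma0 (((⟨1, 0, 1, 0, -3⟩ : WeierstrassCurve ℤ).baseChange ℚ).conductorNorm ℤ)) 2),
      kato_divisibility_allPrimes ((⟨1, 0, 1, 0, -3⟩ : WeierstrassCurve ℤ).baseChange ℚ) 2 (f := f))
    (hper : realPeriodRat_eq_unit_mul_plusPeriod_two) (hmod : nonempty_modularParametrizationData)
    (hr : ((⟨1, 0, 1, 0, -3⟩ : WeierstrassCurve ℤ).baseChange ℚ).analyticRank = 0)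
    (hL : ∃ q : ℚ, q ≠ 0 ∧ ((⟨1, 0, 1, 0, -3⟩ : WeierstrassCurve ℤ).baseChange ℚ).entireLFunction 1 /
      ((((⟨1, 0, 1, 0, -3⟩ : WeierstrassCurve ℤ).baseChange ℚ).realPeriodRat : ℂ)) = (q : ℂ) ∧ padicValRat 2 q = 0) :
    (((⟨1, 0, 1, 0, -3⟩ : WeierstrassCurve ℤ).baseChange ℚ).quadraticTwist 2).selmerCorank 2 ≤ 1 ∧
      (((⟨1, 0, 1, 0, -3⟩ : WeierstrassCurve ℤ).baseChange ℚ).quadraticTwist 2).mordellWeilRank ≤ 1 :=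
  selmerCorank_quadraticTwist_two_le_one_of_road_of_lValue _ h17 hper hmod Summit.BirchSwinnertonDyer.BirchSwinnertonDyer.Theorems.AlignedTransportAtTwoCubicChevalleyRowN3371.goodOrd_two_n3371
    Summit.BirchSwinnertonDyer.BirchSwinnertonDyer.Theorems.AlignedTransportAtTwoCubicChevalleyRowN3371.not_hasRationalTwoTorsionX_n3371
    (by rw [frobeniusTrace, Literature.NumberTheory.EllipticCurves.reductionPointCount_baseChange_int, Summit.BirchSwinnertonDyer.BirchSwinnertonDyer.Theorems.AlignedTransportAtTwoCubicChevalleyRowN3371.M3371_card_two]; decide)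
    Summit.BirchSwinnertonDyer.BirchSwinnertonDyer.Theorems.AlignedTransportAtTwoCubicChevalleyRowN3371.odd_tamagawaProduct_n3371
    (Or.inr (by rw [Summit.BirchSwinnertonDyer.BirchSwinnertonDyer.Theorems.AlignedTransportAtTwoCubicChevalleyRowN3371.minimalDiscriminantInt_n3371]; decide)) hr hL

/-- ★ **Conductor `3547` (`[1, -1, 0, 4, -1]`): `corank_{ℤ₂} Sel_{2^∞}(E⁽²⁾/ℚ) ≤ 1` and `rank E⁽²⁾(ℚ) ≤ 1` for the twist by `2`** (conductor `64·3547`), modulo PRINT `h17`, `hper`, `hmod`,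
the certificate `r_an(E) = 0` and the `L`-value datum (`q = 1` numerically); `a₂ = +1` (`#Ẽ(𝔽₂) = 2`), `Δ_min = −3547 ≡ 5 (mod 8)`, `∏ c_v` odd, good ordinary at `2`, no rational `2`-torsion abscissa
are the row file's kernel facts. [cite: Kato2004Asterisque, Thm. 17.4 (1)(2) (p. 273)] [cite: Cremona1997, Table 1 (curve of conductor 3547)] -/
theorem selmerCorank_quadraticTwist_two_le_one_n3547
    [((⟨1, -1, 0, 4, -1⟩ : WeierstrassCurve ℤ).baseChange ℚ).IsElliptic] [((⟨1, -1, 0, 4, -1⟩ : WeierstrassCurve ℤ).baseChange ℚ).IsGloballyMinimal]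
    (h17 : ∀ [NeZero (((⟨1, -1, 0, 4, -1⟩ : WeierstrassCurve ℤ).baseChange ℚ).conductorNorm ℤ)]
      (f : CuspForm (Gamma0 (((⟨1, -1, 0, 4, -1⟩ : WeierstrassCurve ℤ).baseChange ℚ).conductorNorm ℤ)) 2),
      kato_divisibility_allPrimes ((⟨1, -1, 0, 4, -1⟩ : WeierstrassCurve ℤ).baseChange ℚ) 2 (f := f))
    (hper : realPeriodRat_eq_unit_mul_plusPeriod_two) (hmod : nonempty_modularParametrizationData)
    (hr : ((⟨1, -1, 0, 4, -1⟩ : WeierstrassCurve ℤ).baseChange ℚ).analyticRank = 0)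
    (hL : ∃ q : ℚ, q ≠ 0 ∧ ((⟨1, -1, 0, 4, -1⟩ : WeierstrassCurve ℤ).baseChange ℚ).entireLFunction 1 /
      ((((⟨1, -1, 0, 4, -1⟩ : WeierstrassCurve ℤ).baseChange ℚ).realPeriodRat : ℂ)) = (q : ℂ) ∧ padicValRat 2 q = 0) :
    (((⟨1, -1, 0, 4, -1⟩ : WeierstrassCurve ℤ).baseChange ℚ).quadraticTwist 2).selmerCorank 2 ≤ 1 ∧
      (((⟨1, -1, 0, 4, -1⟩ : WeierstrassCurve ℤ).baseChange ℚ).quadraticTwist 2).mordellWeilRank ≤ 1 :=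
  selmerCorank_quadraticTwist_two_le_one_of_road_of_lValue _ h17 hper hmod Summit.BirchSwinnertonDyer.BirchSwinnertonDyer.Theorems.AlignedTransportAtTwoCubicChevalleyRowN3547.goodOrd_two_n3547
    Summit.BirchSwinnertonDyer.BirchSwinnertonDyer.Theorems.AlignedTransportAtTwoCubicChevalleyRowN3547.not_hasRationalTwoTorsionX_n3547
    (by rw [frobeniusTrace, Literature.NumberTheory.EllipticCurves.reductionPointCount_baseChange_int, Summit.BirchSwinnertonDyer.BirchSwinnertonDyer.Theorems.AlignedTransportAtTwoCubicChevalleyRowN3547.M3547_card_two]; decide)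
    Summit.BirchSwinnertonDyer.BirchSwinnertonDyer.Theorems.AlignedTransportAtTwoCubicChevalleyRowN3547.odd_tamagawaProduct_n3547
    (Or.inr (by rw [Summit.BirchSwinnertonDyer.BirchSwinnertonDyer.Theorems.AlignedTransportAtTwoCubicChevalleyRowN3547.minimalDiscriminantInt_n3547]; decide)) hr hL

/-- ★ **Conductor `4771` (`[1, -1, 0, -11, -12]`): `corank_{ℤ₂} Sel_{2^∞}(E⁽²⁾/ℚ) ≤ 1` and `rank E⁽²⁾(ℚ) ≤ 1` for the twist by `2`** (conductor `64·4771`), modulo PRINT `h17`, `hper`, `hmod`,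
the certificate `r_an(E) = 0` and the `L`-value datum (`q = 1` numerically); `a₂ = +1` (`#Ẽ(𝔽₂) = 2`), `Δ_min = −4771 ≡ 5 (mod 8)`, `∏ c_v` odd, good ordinary at `2`, no rational `2`-torsion abscissa
are the row file's kernel facts. [cite: Kato2004Asterisque, Thm. 17.4 (1)(2) (p. 273)] [cite: Cremona1997, Table 1 (curve of conductor 4771)] -/
theorem selmerCorank_quadraticTwist_two_le_one_n4771
    [((⟨1, -1, 0, -11, -12⟩ : WeierstrassCurve ℤ).baseChange ℚ).IsElliptic] [((⟨1, -1, 0, -11, -12⟩ : WeierstrassCurve ℤ).baseChange ℚ).IsGloballyMinimal]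
    (h17 : ∀ [NeZero (((⟨1, -1, 0, -11, -12⟩ : WeierstrassCurve ℤ).baseChange ℚ).conductorNorm ℤ)]
      (f : CuspForm (Gamma0 (((⟨1, -1, 0, -11, -12⟩ : WeierstrassCurve ℤ).baseChange ℚ).conductorNorm ℤ)) 2),
      kato_divisibility_allPrimes ((⟨1, -1, 0, -11, -12⟩ : WeierstrassCurve ℤ).baseChange ℚ) 2 (f := f))
    (hper : realPeriodRat_eq_unit_mul_plusPeriod_two) (hmod : nonempty_modularParametrizationData)
    (hr : ((⟨1, -1, 0, -11, -12⟩ : WeierstrassCurve ℤ).baseChange ℚ).analyticRank = 0)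
    (hL : ∃ q : ℚ, q ≠ 0 ∧ ((⟨1, -1, 0, -11, -12⟩ : WeierstrassCurve ℤ).baseChange ℚ).entireLFunction 1 /
      ((((⟨1, -1, 0, -11, -12⟩ : WeierstrassCurve ℤ).baseChange ℚ).realPeriodRat : ℂ)) = (q : ℂ) ∧ padicValRat 2 q = 0) :
    (((⟨1, -1, 0, -11, -12⟩ : WeierstrassCurve ℤ).baseChange ℚ).quadraticTwist 2).selmerCorank 2 ≤ 1 ∧
      (((⟨1, -1, 0, -11, -12⟩ : WeierstrassCurve ℤ).baseChange ℚ).quadraticTwist 2).mordellWeilRank ≤ 1 :=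
  selmerCorank_quadraticTwist_two_le_one_of_road_of_lValue _ h17 hper hmod Summit.BirchSwinnertonDyer.BirchSwinnertonDyer.Theorems.AlignedTransportAtTwoCubicChevalleyRowN4771.goodOrd_two_n4771
    Summit.BirchSwinnertonDyer.BirchSwinnertonDyer.Theorems.AlignedTransportAtTwoCubicChevalleyRowN4771.not_hasRationalTwoTorsionX_n4771
    (by rw [frobeniusTrace, Literature.NumberTheory.EllipticCurves.reductionPointCount_baseChange_int, Summit.BirchSwinnertonDyer.BirchSwinnertonDyer.Theorems.AlignedTransportAtTwoCubicChevalleyRowN4771.M4771_card_two]; decide)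
    Summit.BirchSwinnertonDyer.BirchSwinnertonDyer.Theorems.AlignedTransportAtTwoCubicChevalleyRowN4771.odd_tamagawaProduct_n4771
    (Or.inr (by rw [Summit.BirchSwinnertonDyer.BirchSwinnertonDyer.Theorems.AlignedTransportAtTwoCubicChevalleyRowN4771.minimalDiscriminantInt_n4771]; decide)) hr hL

/-- ★ **Conductor `4883` (`[1, 1, 0, -1, -4]`): `corank_{ℤ₂} Sel_{2^∞}(E⁽²⁾/ℚ) ≤ 1` and `rank E⁽²⁾(ℚ) ≤ 1` for the twist by `2`** (conductor `64·4883`), modulo PRINT `h17`, `hper`, `hmod`,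
the certificate `r_an(E) = 0` and the `L`-value datum (`q = 1` numerically); `a₂ = +1` (`#Ẽ(𝔽₂) = 2`), `Δ_min = −4883 ≡ 5 (mod 8)`, `∏ c_v` odd, good ordinary at `2`, no rational `2`-torsion abscissa
are the row file's kernel facts. [cite: Kato2004Asterisque, Thm. 17.4 (1)(2) (p. 273)] [cite: Cremona1997, Table 1 (curve of conductor 4883)] -/
theorem selmerCorank_quadraticTwist_two_le_one_n4883
    [((⟨1, 1, 0, -1, -4⟩ : WeierstrassCurve ℤ).baseChange ℚ).IsElliptic] [((⟨1, 1, 0, -1, -4⟩ : WeierstrassCurve ℤ).baseChange ℚ).IsGloballyMinimal]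
    (h17 : ∀ [NeZero (((⟨1, 1, 0, -1, -4⟩ : WeierstrassCurve ℤ).baseChange ℚ).conductorNorm ℤ)]
      (f : CuspForm (Gamma0 (((⟨1, 1, 0, -1, -4⟩ : WeierstrassCurve ℤ).baseChange ℚ).conductorNorm ℤ)) 2),
      kato_divisibility_allPrimes ((⟨1, 1, 0, -1, -4⟩ : WeierstrassCurve ℤ).baseChange ℚ) 2 (f := f))
    (hper : realPeriodRat_eq_unit_mul_plusPeriod_two) (hmod : nonempty_modularParametrizationData)
    (hr : ((⟨1, 1, 0, -1, -4⟩ : WeierstrassCurve ℤ).baseChange ℚ).analyticRank = 0)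
    (hL : ∃ q : ℚ, q ≠ 0 ∧ ((⟨1, 1, 0, -1, -4⟩ : WeierstrassCurve ℤ).baseChange ℚ).entireLFunction 1 /
      ((((⟨1, 1, 0, -1, -4⟩ : WeierstrassCurve ℤ).baseChange ℚ).realPeriodRat : ℂ)) = (q : ℂ) ∧ padicValRat 2 q = 0) :
    (((⟨1, 1, 0, -1, -4⟩ : WeierstrassCurve ℤ).baseChange ℚ).quadraticTwist 2).selmerCorank 2 ≤ 1 ∧
      (((⟨1, 1, 0, -1, -4⟩ : WeierstrassCurve ℤ).baseChange ℚ).quadraticTwist 2).mordellWeilRank ≤ 1 :=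
  selmerCorank_quadraticTwist_two_le_one_of_road_of_lValue _ h17 hper hmod Summit.BirchSwinnertonDyer.BirchSwinnertonDyer.Theorems.AlignedTransportAtTwoCubicChevalleyRowN4883.goodOrd_two_n4883
    Summit.BirchSwinnertonDyer.BirchSwinnertonDyer.Theorems.AlignedTransportAtTwoCubicChevalleyRowN4883.not_hasRationalTwoTorsionX_n4883
    (by rw [frobeniusTrace, Literature.NumberTheory.EllipticCurves.reductionPointCount_baseChange_int, Summit.BirchSwinnertonDyer.BirchSwinnertonDyer.Theorems.AlignedTransportAtTwoCubicChevalleyRowN4883.M4883_card_two]; decide)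
    Summit.BirchSwinnertonDyer.BirchSwinnertonDyer.Theorems.AlignedTransportAtTwoCubicChevalleyRowN4883.odd_tamagawaProduct_n4883
    (Or.inr (by rw [Summit.BirchSwinnertonDyer.BirchSwinnertonDyer.Theorems.AlignedTransportAtTwoCubicChevalleyRowN4883.minimalDiscriminantInt_n4883]; decide)) hr hL

end Rows

end Summit.BirchSwinnertonDyer.BirchSwinnertonDyer.Theorems.AlignedTransportAtTwoTwistReadingRows

end
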